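import Literature.NumberTheory.Automorphic.Liu2021.LocalNormClassFlip
import Literature.NumberTheory.GelbartRogawski1991.UnitaryDualPairThetaKernelCM
import HarnessLib

/-!
# Crux `HLiu418`, pay-down line `F0_P5_CurveThetaLettersPaydown` — stub **A** `stub_arith_relabelParity : RelabelParity₂`
# (the RELABELLING PARITY), closed over ★ `RemD5.not_isAdmissible_companion_of_ne_on_anisotropic`

Cell hodgecm-mathlib (D-0151), FLOOR 0, programme P5 (Alb-CM), crux item `HLiu418` = stmt-HodgeConjecture-24832; pay-down line
`Cruxes/HLiu418/Lines/F0_P5_CurveThetaLettersPaydown.lean` (registrar F0P5-plan (g4); tree sha16 a0c52fcddf899c77, 354 l.), registered stub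
**A `stub_arith_relabelParity : RelabelParity₂`** (§1 ∕ §2 there; ARITHMETIC, size XS–S).  THEOREMS ONLY (no definition, no instance, no notation,
no named fact, no `sorry`); `--supports stmt-HodgeConjecture-24832`.  HONEST LABEL: HC_CM is proved only modulo the 2 remaining named inputs
(hLiu418, h413) until rung 0 closes; this file pays down nothing by itself — it closes ONE registered stub of the pay-down line of letter #74.

THE STATEMENT (`RelabelParity₂` of the Lines file, UNFOLDED verbatim — a `Theorems/` file cannot import a `Cruxes/…/Lines/` module): for the
registered binary frame `diag dV` (real diagonal, signature `(1,1)` at `ι`, definite at the other places, `[L:ℚ] ≥ 4`), a CM type `Φ` of the CM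
field `L`, and two units `a, a′` of `L⁺` whose local norm classes `locF … a′ v`, `locF … a v ∈ L⁺_vˣ ⧸ N(L_vˣ)` AGREE exactly at the finite places
`v` where the hermitian plane `(L_v², diag dV ⊗ 1)` is ISOTROPIC: if `Φ` is admissible for `ε_a` in the letters' [Liu2021, Def. 4.12] currency
(`∃ e, IsAdmissibleElement L Φ e ∧ epsOf … (2δ_L)⁻¹ e = locF a`), then the CONJUGATE type `Φ̄` is NOT admissible for `ε_{a′}`.

PROOF = ★ `Literature.NumberTheory.Automorphic.Liu2021.RemD5.not_isAdmissible_companion_of_ne_on_anisotropic` (module `LocalNormClassFlip`, the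
Case-B companion statement: Hilbert reciprocity ★ `even_ncard_not_isIsotropic_add_finrank_sub_one` + the parity form of admissibility ★
`isAdmissible_epsOf_iff_even_card`) instantiated at the conjugate type `Ψ := Φ̄`, `δ₁ := δ_L = imagUnit L`, `d := δ_L² = imagUnitSq L`, normaliser
`δ := (2δ_L)⁻¹`, `ε := locF a`, `ε′ := locF a′`; the letters' form `epsOf δ e` is the pinned form `epsOf δ (−e)` of ★ for the conjugate type
(★ `RemD5.exists_isAdmissibleElement_neg_iff_bar`, `Φ̄̄ = Φ`); the flip hypotheses `hoff` ∕ `hon` of ★ are the two directions of the registered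
`locF a′ v = locF a v ↔ isotropic` clause, read at the (provable, proved here) hermitian-symmetry and non-degeneracy witnesses of `diag dV`.
The degree clause `4 ≤ [L:ℚ]` of the registered signature is carried and not used.

* `conjTranspose_diagonal_of_real`, `det_diagonal_ne_zero_of_ne_zero` — `diag dV` is hermitian and non-degenerate (the witnesses at which the
  registered flip clause is read); the two normaliser facts «`(2δ_L)⁻¹` purely imaginary, non-zero» (= ★ `H413.ThetaPinBridge.complexConj_two_mul_imagUnit_inv`
  ∕ `two_mul_imagUnit_inv_ne_zero`, one-liners) are INLINED at the call site so that this closer adds nothing to the import closure of the Lines module;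
* `relabelParity_holds` — the registered signature of `RelabelParity₂`, verbatim; the registrar's fold in the Lines file is the one-liner
  `theorem stub_arith_relabelParity : RelabelParity₂ := F0P5CurveThetaStubRelabelParity.relabelParity_holds`.

## References
* [Liu2021] Y. Liu, *Fourier–Jacobi cycles and arithmetic relative trace formula*, Camb. J. Math. 9 (2021) = arXiv:2102.11518: Def. 4.12
  (l. 2102–2108), Rem. 4.4; App. D Lem. D.1 (4) (l. 5235), §D.3 (l. 5355).
* [Omeara1963] O. T. O'Meara, *Introduction to Quadratic Forms* (1963), §63B Cor. 63:13a, §71 Thm. 71:18.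
-/

set_option autoImplicit false

-- the mandated namespace has the single-problem summit's repeated segment (`HodgeConjecture.HodgeConjecture`)
set_option linter.dupNamespace false

noncomputable section

open NumberField NumberField.InfinitePlace IsDedekindDomain
open scoped Matrix ComplexOrder
open Literature.NumberTheory.Automorphic Literature.NumberTheory.Automorphic.UnitaryGroup
open Literature.NumberTheory.Automorphic.Liu2021 Literature.NumberTheory.Automorphic.Liu2021.Def411WeilCarriers
open Literature.AlgebraicGeometry.Liu2021 (IsAdmissibleElement)
open Literature.AlgebraicGeometry.Motives (CMType)
open Literature.NumberTheory.ComplexMultiplication (CMTypeOps.bar CMTypeOps.mem_bar_iff)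
open Literature.NumberTheory.GelbartRogawski1991 Literature.NumberTheory.GelbartRogawski1991.UnitaryDualPair

namespace Summit.HodgeConjecture.HodgeConjecture.Cruxes.HLiu418.F0P5CurveThetaStubRelabelParity

section Frame

variable (L : Type) [Field L] [NumberField L] [IsCMField L]

/-- A real diagonal form is hermitian: `ᵗ(\overline{diag dV}) = diag dV` when every `dVᵢ` is fixed by complex conjugation. [folklore] -/
theorem conjTranspose_diagonal_of_real {N : ℕ} (dV : Fin N → L) (hdV : ∀ i, IsCMField.complexConj L (dV i) = dV i) :
    ((Matrix.diagonal dV).map (IsCMField.complexConj L))ᵀ = Matrix.diagonal dV := by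
  rw [Matrix.diagonal_map (map_zero (IsCMField.complexConj L)), Matrix.diagonal_transpose]
  exact congrArg Matrix.diagonal (funext hdV)

omit [NumberField L] [IsCMField L] in
/-- A diagonal form with non-zero entries is non-degenerate: `det (diag dV) ≠ 0`. [folklore] -/
theorem det_diagonal_ne_zero_of_ne_zero {N : ℕ} (dV : Fin N → L) (hdV0 : ∀ i, dV i ≠ 0) : (Matrix.diagonal dV).det ≠ 0 := by
  rw [Matrix.det_diagonal]
  exact Finset.prod_ne_zero_iff.2 fun i _ => hdV0 i

end Frame

/-- **Stub A `stub_arith_relabelParity : RelabelParity₂` — the RELABELLING PARITY** (registered signature, verbatim): if `Φ` is admissible for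
`ε_a` ([Liu2021, Def. 4.12] currency of the letters, normaliser `(2δ_L)⁻¹`) and the local norm classes of `a′` agree with those of `a` exactly at
the isotropic places of the registered frame `diag dV`, then the conjugate type `Φ̄` is NOT admissible for `ε_{a′}`.  Proof: ★
`RemD5.not_isAdmissible_companion_of_ne_on_anisotropic` at `Ψ := Φ̄` (Hilbert reciprocity: the anisotropic count has the parity of `[L⁺:ℚ] − 1`;
[Liu2021, Def. 4.12] in parity form), the letters' `epsOf δ e` being the pinned `epsOf δ (−e)` of the conjugate type (★
`RemD5.exists_isAdmissibleElement_neg_iff_bar`, `Φ̄̄ = Φ`).  The clause `4 ≤ [L:ℚ]` is carried, not used.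
[cite: Liu2021, Def. 4.12 (l. 2102–2108); App. D Lem. D.1 (4) (l. 5235), §D.3 (l. 5355)] [cite: Omeara1963, §71 Thm. 71:18] -/
theorem relabelParity_holds :
    ∀ (L : Type) [Field L] [NumberField L] [IsCMField L] (ι : L →+* ℂ)
    (dV : Fin 2 → L) (hdV : ∀ i, IsCMField.complexConj L (dV i) = dV i) (hdV0 : ∀ i, dV i ≠ 0),
    (∃ T : GL (Fin 2) ℂ, formCongr (starRingEnd ℂ) T ((Matrix.diagonal dV).map ι) = Matrix.diagonal ![(1 : ℂ), -1]) →
    (∀ τ' : L →+* ℂ, InfinitePlace.mk τ' ≠ InfinitePlace.mk ι → ((Matrix.diagonal dV).map τ').PosDef) →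
    4 ≤ Module.finrank ℚ L →
    ∀ (Φ : CMType L) (a a' : (↥(maximalRealSubfield L))ˣ),
      (∀ (hJh : ((Matrix.diagonal dV).map (IsCMField.complexConj L))ᵀ = Matrix.diagonal dV) (hJdet : (Matrix.diagonal dV).det ≠ 0)
          (v : HeightOneSpectrum (𝓞 ↥(maximalRealSubfield L))),
        locF (↥(maximalRealSubfield L)) (imagUnitSq L) a' v = locF (↥(maximalRealSubfield L)) (imagUnitSq L) a v ↔
          LemD1.IsIsotropic (LemD1OfPlace.standingData L v (IsCMField.complexConj L) 2 (Matrix.diagonal dV)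
            (complexConj_imagUnit L) (imagUnit_ne_zero L) le_rfl hJh hJdet)) →
      (∃ e : L, IsAdmissibleElement L Φ.1 e ∧
          epsOf (↥(maximalRealSubfield L)) (imagUnitSq L) L (2 * imagUnit L)⁻¹ e = locF (↥(maximalRealSubfield L)) (imagUnitSq L) a) →
      ¬ ∃ e : L, IsAdmissibleElement L (CMTypeOps.bar Φ).1 e ∧
          epsOf (↥(maximalRealSubfield L)) (imagUnitSq L) L (2 * imagUnit L)⁻¹ e = locF (↥(maximalRealSubfield L)) (imagUnitSq L) a' := by
  intro L _ _ _ ι dV hdV hdV0 hsig hdef _h4 Φ a a' hflip hadm hcontra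
  -- the hermitian-symmetry and non-degeneracy witnesses of `diag dV` at which the registered FLIP clause is read
  have hJh : ((Matrix.diagonal dV).map (IsCMField.complexConj L))ᵀ = Matrix.diagonal dV := conjTranspose_diagonal_of_real L dV hdV
  have hJdet : (Matrix.diagonal dV).det ≠ 0 := det_diagonal_ne_zero_of_ne_zero L dV hdV0
  -- `Φ̄̄ = Φ`
  have hbb : CMTypeOps.bar (CMTypeOps.bar Φ) = Φ := Subtype.ext (compl_compl Φ.1)
  -- the letters' admissibility of `ε_a` for `Φ` is the pinned admissibility (`epsOf δ (−e)`) of `ε_a` for `Φ̄`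
  have hadm' : ∃ e : L, IsAdmissibleElement L (CMTypeOps.bar Φ).1 e ∧
      epsOf (↥(maximalRealSubfield L)) (imagUnitSq L) L (2 * imagUnit L)⁻¹ (-e) = locF (↥(maximalRealSubfield L)) (imagUnitSq L) a := by
    rw [RemD5.exists_isAdmissibleElement_neg_iff_bar, hbb]
    exact hadm
  -- … and the (supposed) letters' admissibility of `ε_{a′}` for `Φ̄` is the pinned admissibility of `ε_{a′}` for `Φ̄̄`
  have hcontra' : ∃ e : L, IsAdmissibleElement L (CMTypeOps.bar (CMTypeOps.bar Φ)).1 e ∧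
      epsOf (↥(maximalRealSubfield L)) (imagUnitSq L) L (2 * imagUnit L)⁻¹ (-e) = locF (↥(maximalRealSubfield L)) (imagUnitSq L) a' := by
    rw [RemD5.exists_isAdmissibleElement_neg_iff_bar, hbb]
    exact hcontra
  -- ★ Case-B companion statement at `Ψ := Φ̄`, `δ₁ := δ_L`, `d := δ_L²`, `δ := (2δ_L)⁻¹`, `ε := locF a`, `ε′ := locF a′`
  exact RemD5.not_isAdmissible_companion_of_ne_on_anisotropic (CMTypeOps.bar Φ) ι dV hdV hdV0 ⟨hsig, hdef⟩
    (complexConj_imagUnit L) (imagUnit_ne_zero L) hJh hJdet (imagUnitSq L) (imagUnit_mul_self L)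
    (show IsCMField.complexConj L (2 * imagUnit L)⁻¹ = -(2 * imagUnit L)⁻¹ by
      rw [map_inv₀, map_mul, map_ofNat, complexConj_imagUnit, mul_neg, inv_neg])
    (inv_ne_zero (mul_ne_zero two_ne_zero (imagUnit_ne_zero L)))
    (locF (↥(maximalRealSubfield L)) (imagUnitSq L) a) (locF (↥(maximalRealSubfield L)) (imagUnitSq L) a')
    (fun v hv => (hflip hJh hJdet v).2 hv) (fun v hv h => hv ((hflip hJh hJdet v).1 h)) hadm' hcontra'

end Summit.HodgeConjecture.HodgeConjecture.Cruxes.HLiu418.F0P5CurveThetaStubRelabelParity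

end
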